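import Summits.BirchSwinnertonDyer.BirchSwinnertonDyer.Theorems.AdditiveBranchIMCGenusGrossZagierFourthCurve
import Summits.BirchSwinnertonDyer.Rank1Residual.AdditivePotMult.PStarTwistModel
import HarnessLib

/-!
# Route `AdditiveBranchIMC`, crux `MultLower` (stmt-19359), line `tame_roads_mult`, stub U-a
# (`stub_genusGrossZagierM`) — part 5b(M): THE FOURTH CURVE `E′` on the (M) road — a globally
# minimal model of `Wd ⊗ χ_{d₁}`, MULTIPLICATIVE at `p`, with the two presentations
# `C₁ • E′^{(d₁)} = Wd`, `C₂′ • E′^{(d₂)} = A`, `p`-unit scalings, and a datum with `p ∤ c`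

Cell `bsd-addord`, seat `bsd-line-addord-w4` (stub-worker under the lead of cruxes 19357 / 19359).
HONEST FRAMING: helper theorems only (no `def`, no named fact, nothing asserted about BSD; the crux
stays OPEN). The (M) twin of part 5b (`exists_fourthCurve_gord`): in the cell (M) of N10
(`N10.CellM Wd p`: `p` odd, `Wd` additive and potentially multiplicative at `p`, i.e. `Wd ≅ V^{(p*)}`
with `V` MULTIPLICATIVE at `p` — tree `AdditivePotMult.PotMult.exists_mult_pStar_twist_model`) the
fourth curve `E′ ≅ Wd^{(d₁)} ≅ V^{(d₁/p*)}` is MULTIPLICATIVE at `p` (unit twist of a multiplicative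
curve, tree `AdditivePotMult.mult_of_model_unit_twist`), so `p ∥ N_{E′}` and Mazur's Cor. 4.1 still
gives a datum with `p ∤ c` (tree `X11b.exists_modularParametrizationData_not_dvd`); the scalings are
`p`-units by Pal's Prop. 2.5 in the multiplicative case (part 3b, `…_of_twist_of_dvd` with `V`
multiplicative). Everything else is verbatim part 5b.

* `not_sq_dvd_conductorNorm_of_mult` — `p² ∤ N_E` at a multiplicative prime (`f_p = 1`).
* `exists_fourthCurve_mult` — the fourth curve on the (M) road.

References: Silverman AEC VII.5 Prop. 5.1, X.5 Cor. 5.4; Silverman ATAEC IV.10.2; Pal 2012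
Prop. 2.5; Mazur 1978 Cor. 4.1.
-/

noncomputable section

open scoped Classical

open WeierstrassCurve NumberField IsDedekindDomain Rat.HeightOneSpectrum
  Literature.NumberTheory.EllipticCurves
  Literature.NumberTheory.EllipticCurves.ModularForms
  Literature.NumberTheory.EllipticCurves.Rank1Residual
  Summit.BirchSwinnertonDyer.Rank1Residual
  Summit.BirchSwinnertonDyer.Rank1Residual.Additive

-- D-0017 layout: summit = sub-problem, so `Summit.BirchSwinnertonDyer.BirchSwinnertonDyer.…` is the
-- mandated namespace (same option as the route's sockets files).
set_option linter.dupNamespace false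
set_option autoImplicit false

namespace Summit.BirchSwinnertonDyer.BirchSwinnertonDyer.Theorems.GenusGrossZagier

/-! ## §1 Bookkeeping -/

/-- **`p² ∤ N_E` at a prime of multiplicative reduction** (`f_p = 1`: tree
`conductorExponent_eq_one_iff_holds`, `factorization_conductorNorm_holds`).
[cite: Silverman1994, IV.10.2(b)] -/
theorem not_sq_dvd_conductorNorm_of_mult (W : WeierstrassCurve ℚ) [W.IsElliptic] (p : ℕ)
    [hp : Fact p.Prime] (hm : W.HasMultiplicativeReductionAtPrime p) :
    ¬ p ^ 2 ∣ W.conductorNorm ℤ := by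
  obtain ⟨v, rfl⟩ : ∃ v : HeightOneSpectrum ℤ, (primesEquiv v : ℕ) = p :=
    ⟨primesEquiv.symm ⟨p, hp.out⟩, by rw [Equiv.apply_symm_apply]⟩
  have h1 : (W.conductorNorm ℤ).factorization (primesEquiv v : ℕ) = 1 := by
    show (W.conductorNorm ℤ).factorization (natGenerator v) = 1
    rw [factorization_conductorNorm_holds W v, conductorExponent_eq_one_iff_holds v W]
    exact (hasMultiplicativeReductionAtPrime_primesEquiv_iff_hasMultiplicativeReductionAt W v).mp hm
  have hpos : W.conductorNorm ℤ ≠ 0 := (W.conductorNorm_pos_holds).ne'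
  intro h
  have h2 := ((primesEquiv v).2.pow_dvd_iff_le_factorization hpos).mp h
  rw [h1] at h2
  omega

/-! ## §2 The fourth curve on the (M) road -/

/-- **The fourth curve `E′` of the three-field road ((M), rank `0`).** For globally minimal `Wd`,
`A` with `Wd` in the (M) cell at the odd prime `p` (`Wd` additive, `ord_p j(Wd) < 0`), `Wd[p]`
irreducible, `C • Wd^{(D)} = A`, and `D` fundamental with a factorisation `d₁ d₂ = D`, `d₁`
fundamental, `p ∣ d₁`: there are a GLOBALLY MINIMAL `E′ ≅ Wd^{(d₁)}` with `C₁ • E′^{(d₁)} = Wd`,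
`C₂′ • E′^{(d₂)} = A`, `ord_p u(C₁) = ord_p u(C₂′) = 0`, a datum `Dt` of `E′` at level `N_{E′}` with
`p ∤ c(Dt)`, and `E′` has MULTIPLICATIVE reduction at `p`. Inputs by name:
`nonempty_modularParametrizationData` (BCDT), `mazur_not_dvd_maninConstant_of_odd` (Mazur 1978
Cor. 4.1, `p ∥ N_{E′}`). [cite: SilvermanAEC2009, X.5 Cor. 5.4 and VII.5 Prop. 5.1]
[cite: Pal2012, Prop. 2.5] [cite: Mazur1978, Cor. 4.1] [cite: JetchevSkinnerWan2017, §7.4.1 and Remark 43] -/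
theorem exists_fourthCurve_mult (hmodP : nonempty_modularParametrizationData)
    (hMaz : mazur_not_dvd_maninConstant_of_odd)
    (Wd A : WeierstrassCurve ℚ) [Wd.IsElliptic] [Wd.IsGloballyMinimal] [A.IsElliptic]
    [A.IsGloballyMinimal] (p : ℕ) [Fact p.Prime] (hcell : N10.CellM Wd p)
    (hirr : Wd.HasIrreducibleModPGaloisRep p) {D d₁ d₂ : ℤ}
    (hD : (D % 4 = 1 ∧ Squarefree D ∧ D ≠ 1) ∨
      (4 ∣ D ∧ (D / 4 % 4 = 2 ∨ D / 4 % 4 = 3) ∧ Squarefree (D / 4)))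
    (hd₁ : (d₁ % 4 = 1 ∧ Squarefree d₁ ∧ d₁ ≠ 1) ∨
      (4 ∣ d₁ ∧ (d₁ / 4 % 4 = 2 ∨ d₁ / 4 % 4 = 3) ∧ Squarefree (d₁ / 4)))
    (hd : d₁ * d₂ = D) (hpd : (p : ℤ) ∣ d₁)
    (htwA : ∃ C : VariableChange ℚ, C • Wd.quadraticTwist (D : ℚ) = A) :
    ∃ (E' : WeierstrassCurve ℚ) (_ : E'.IsElliptic) (_ : E'.IsGloballyMinimal)
      (_ : NeZero (E'.conductorNorm ℤ)) (C₁ C₂' : VariableChange ℚ)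
      (Dt : ModularParametrizationData E' (E'.conductorNorm ℤ)),
      (∃ C : VariableChange ℚ, C • Wd.quadraticTwist (d₁ : ℚ) = E') ∧
      C₁ • E'.quadraticTwist (d₁ : ℚ) = Wd ∧ C₂' • E'.quadraticTwist (d₂ : ℚ) = A ∧
      padicValRat p (C₁.u : ℚ) = 0 ∧ padicValRat p (C₂'.u : ℚ) = 0 ∧ ¬ (p : ℤ) ∣ Dt.c ∧
      E'.HasMultiplicativeReductionAtPrime p := by
  have hp : p.Prime := Fact.out
  obtain ⟨hp2, hadd, hpotm⟩ := hcell
  -- §a arithmetic of `d₁ = p* · d₁'`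
  have hd10 : d₁ ≠ 0 := by rintro rfl; rcases hd₁ with ⟨h, -, -⟩ | ⟨-, h, -⟩ <;> norm_num at h
  have hd1Q : (d₁ : ℚ) ≠ 0 := by exact_mod_cast hd10
  have hD0 : D ≠ 0 := by rintro rfl; rcases hD with ⟨h, -, -⟩ | ⟨-, h, -⟩ <;> norm_num at h
  have hDQ : (D : ℚ) ≠ 0 := by exact_mod_cast hD0
  have hd20 : d₂ ≠ 0 := by rintro rfl; rw [mul_zero] at hd; exact hD0 hd.symm
  obtain ⟨hcast, hpm⟩ := pStar_intCast p
  set e : ℤ := (-1 : ℤ) ^ (p / 2) * p with hedef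
  have he4 : e % 4 = 1 := by
    obtain ⟨k, hk⟩ := exists_four_mul_add_one_eq_pStar p hp2
    rw [hedef, ← hk]; omega
  obtain ⟨hshape, hde, hnd⟩ := isFundamental_or_eq_one_div_primeDiscr hp hp2 he4 hpm hd₁ hpd
  set d₁' : ℤ := d₁ / e with hd₁'
  have hpsq : ¬ (p : ℤ) ^ 2 ∣ d₁ := not_sq_dvd_of_isFundamental_of_ne_two hd₁ hp hp2
  have hpD : ¬ (p : ℤ) ^ 2 ∣ D := not_sq_dvd_of_isFundamental_of_ne_two hD hp hp2
  have hpd₂ : ¬ (p : ℤ) ∣ d₂ := fun h => hpD (by rw [← hd, sq]; exact mul_dvd_mul hpd h)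
  -- §b the semistable twist model `V`: `CV • V^{(p*)} = Wd`, `V` MULTIPLICATIVE at `p`
  obtain ⟨V, iV, iVm, CV, hmultV, hCV⟩ :=
    AdditivePotMult.PotMult.exists_mult_pStar_twist_model (W := Wd) (p := p) ⟨hadd, hpotm⟩ hp2
  -- §c the fourth curve: a globally minimal model of `Wd^{(d₁)}`
  haveI := Wd.isElliptic_quadraticTwist hd1Q
  obtain ⟨C', hC'min⟩ := hasGlobalMinimalModel_rat_holds (Wd.quadraticTwist (d₁ : ℚ))
  set E' : WeierstrassCurve ℚ := C' • Wd.quadraticTwist (d₁ : ℚ) with hE'def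
  haveI : E'.IsGloballyMinimal := hC'min
  haveI hnz : NeZero (E'.conductorNorm ℤ) := ⟨(conductorNorm_pos_holds E').ne'⟩
  -- §d `C₁ • E′^{(d₁)} = Wd` (twisting twice by `d₁` is the square twist)
  obtain ⟨C₀, hC₀⟩ := Wd.exists_variableChange_smul_eq_quadraticTwist_sq hd1Q
  have hE'tw : E'.quadraticTwist (d₁ : ℚ) =
      ((⟨C'.u, (d₁ : ℚ) * C'.r, 0, 0⟩ : VariableChange ℚ) * C₀) • Wd := by
    rw [hE'def, WeierstrassCurve.quadraticTwist_smul, quadraticTwist_quadraticTwist, mul_smul, hC₀, sq]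
  set C₁ : VariableChange ℚ := ((⟨C'.u, (d₁ : ℚ) * C'.r, 0, 0⟩ : VariableChange ℚ) * C₀)⁻¹ with hC₁def
  have hC₁ : C₁ • E'.quadraticTwist (d₁ : ℚ) = Wd := by rw [hE'tw, hC₁def, inv_smul_smul]
  -- §e `C₂′ • E′^{(d₂)} = A`: `A ≅ Wd^{(D)} ≅ E′^{(d₁ D)} = E′^{(d₂ d₁²)} ≅ E′^{(d₂)}`
  obtain ⟨CA, hCA⟩ := htwA
  obtain ⟨C₃, hC₃⟩ := E'.exists_variableChange_quadraticTwist_mul_sq (d₂ : ℚ) (d₁ : ℚ) hd1Q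
  have hA' : A = (CA * (⟨C₁.u, (D : ℚ) * C₁.r, 0, 0⟩ : VariableChange ℚ) * C₃) •
      E'.quadraticTwist (d₂ : ℚ) := by
    rw [mul_smul, mul_smul, hC₃, show (d₂ : ℚ) * (d₁ : ℚ) ^ 2 = (d₁ : ℚ) * (D : ℚ) by
      rw [← hd]; push_cast; ring, ← quadraticTwist_quadraticTwist, ← WeierstrassCurve.quadraticTwist_smul, hC₁, hCA]
  set C₂' : VariableChange ℚ := CA * (⟨C₁.u, (D : ℚ) * C₁.r, 0, 0⟩ : VariableChange ℚ) * C₃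
    with hC₂'def
  have hC₂' : C₂' • E'.quadraticTwist (d₂ : ℚ) = A := hA'.symm
  -- §f `E′` is MULTIPLICATIVE at `p`: `E′ ≅ V^{(d₁')}` with `p ∤ d₁'`
  haveI : (V.quadraticTwist ((-1 : ℚ) ^ (p / 2) * p)).IsElliptic :=
    V.isElliptic_quadraticTwist (by rw [← hcast]; exact_mod_cast (show e ≠ 0 by rintro h; rw [h] at he4; norm_num at he4))
  obtain ⟨C₄, hC₄⟩ := V.exists_variableChange_quadraticTwist_mul_sq (d₁' : ℚ) ((-1 : ℚ) ^ (p / 2) * p)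
    (by rw [← hcast]; exact_mod_cast (show e ≠ 0 by rintro h; rw [h] at he4; norm_num at he4))
  have hE'V : (C' * (⟨CV.u, (d₁ : ℚ) * CV.r, 0, 0⟩ : VariableChange ℚ) * C₄) •
      V.quadraticTwist (d₁' : ℚ) = E' := by
    rw [mul_smul, mul_smul, hC₄, show (d₁' : ℚ) * ((-1 : ℚ) ^ (p / 2) * p) ^ 2 =
        ((-1 : ℚ) ^ (p / 2) * p) * (d₁ : ℚ) by rw [hde, ← hcast]; push_cast; ring,
      ← quadraticTwist_quadraticTwist, ← WeierstrassCurve.quadraticTwist_smul, hCV, hE'def]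
  have hd1'0 : (d₁' : ℚ) ≠ 0 := by
    have : d₁' ≠ 0 := fun h => hnd (by rw [h]; exact dvd_zero _)
    exact_mod_cast this
  have hd1'u : padicValRat p (d₁' : ℚ) = 0 := by
    rw [padicValRat.of_int, Int.natCast_eq_zero]
    exact padicValInt.eq_zero_of_not_dvd hnd
  have hmultE' : E'.HasMultiplicativeReductionAtPrime p :=
    AdditivePotMult.mult_of_model_unit_twist hp2 hd1'0 hd1'u hmultV ⟨_, hE'V⟩
  -- §g the scalings are `p`-units (Pal 2012 Prop. 2.5; part 3b)
  have hu₁ : padicValRat p (C₁.u : ℚ) = 0 :=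
    padicValRat_u_eq_zero_of_twist_of_dvd E' hp2 hpd hpsq (Or.inr hmultE') Wd C₁ hC₁
  have hu₂ : padicValRat p (C₂'.u : ℚ) = 0 :=
    padicValRat_u_eq_zero_of_twist_of_not_dvd E' hp2 hpd₂ A C₂' hC₂'
  -- §h a datum with `p ∤ c`: `p ∥ N_{E′}`, `E′[p]` irreducible
  have hpN : ¬ p ^ 2 ∣ E'.conductorNorm ℤ := not_sq_dvd_conductorNorm_of_mult E' p hmultE'
  have hirrE' : E'.HasIrreducibleModPGaloisRep p := by
    rw [hE'def, Mazur1978.hasIrreducibleModPGaloisRep_smul_iff,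
      Wd.hasIrreducibleModPGaloisRep_quadraticTwist_iff hd1Q p]
    exact hirr
  obtain ⟨Dt, hc⟩ := X11b.exists_modularParametrizationData_not_dvd
    (exists_isNewformOf_of_nonempty_modularParametrizationData hmodP) hMaz
    integral_neronScaling_of_isGloballyMinimal_holds E' rfl hp hp2 hpN hirrE'
  exact ⟨E', inferInstance, hC'min, hnz, C₁, C₂', Dt, ⟨C', rfl⟩, hC₁, hC₂', hu₁, hu₂, hc, hmultE'⟩

end Summit.BirchSwinnertonDyer.BirchSwinnertonDyer.Theorems.GenusGrossZagier

end
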